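import Summits.AtomisticToContinuum.BoseEinsteinCondensation.Theorems.BECRewardDescentRewardChordBoundSecantWalk
import Summits.AtomisticToContinuum.BoseEinsteinCondensation.Theorems.BECRewardDescentRewardScaleChord

/-!
# Crux `RewardChordBound` (stmt-AtomisticToContinuum-12876) — the sorry-free REDUCTION of the crux to the ONE-SHELL
# inequality `ShellModulus` (line `dyadic-secant`, crux strategist `cstrat-stmt-AtomisticToContinuum-12876-s1`)

Route `route-AtomisticToContinuum-BECRewardDescent`, sub-problem `BoseEinsteinCondensation`. Helper file (it does not close
the item): it records in the tree, kernel-checked, the second reduction of the crux. The first (line `registered`/birth,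
`BECRewardDescentRewardChordBoundReduction.lean` + the hard-core Perron–Frobenius kernel
`BECRewardDescentRewardChordBoundSimpleNonintegrable.lean`) is `RewardChordBound ⇐ SectorGap ∧ CondensateVariance`
(items 12874, 12875: a `P = 0` Ky-Fan gap `c√(ρa s)` and a variance bound `Var n̂₀ ≤ CN` for condensed near-minimisers of
the rewarded torus gas, uniformly in `N`). This one needs NO spectral object:

* `rewardChordBound_at_of_shellModulus_at` — at a FIXED repulsive finite-range `v`: if at low density, eventually in `N`,
  every reward shell `(u, 4u]` with `4u ≤ σρa` whose upper half-shell `(2u, 4u]` carries `(1−η)`-condensed near-minimisers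
  satisfies the three-energy inequality `3R(2u) ≤ 2R(u) + R(4u) + K·N·u·√(u/(ρa))` for the reward infimum
  `R(t) = inf_Ψ ⟨Ψ,HΨ⟩ + t(N − n₀(Ψ))`, then the body of `RewardChordBound` holds at `v` for every `τ > 0`;
* `rewardChordBound_of_shellModulus` — `ShellModulus → RewardChordBound` for the global statements (the hypothesis is
  verbatim the registered stub `stub_shellModulus` of the crux skeleton `Cruxes/RewardChordBound/Lines/birth.lean`).

Ingredients: the landed stub `DyadicSecant.stub_secantWalk` (the discrete reward walk, real analysis), the proved route
item `RewardScaleChord` (`Theorems.rewardScaleChord_proof`, item 12877) at slope `η/4`, `PeriodicEnergyFinite_holds`, and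
`Birth.ChordFromModulus.condensed_of_depletion_lt` (`N − n₀ < ηN ⇒ (1−η)N ≤ n₀`). So the crux is closed MODULO exactly the
one-shell inequality, whose tail `u → 0⁺` (uniformly in `N`) is the thermodynamic-limit content.

References: route text of BECRewardDescent; strategist card `Cruxes/RewardChordBound/Lines/dyadic-secant.md`;
[Griffiths1966] §III; [Kato1966] Ch. VII §3; [LSSY2005] Ch. 5.
-/

namespace Summit.AtomisticToContinuum.BoseEinsteinCondensation.Cruxes.RewardChordBound.DyadicSecant

open scoped BigOperators Topology Classical ENNReal
open Filter Set

open Literature.MathematicalPhysics.QuantumManyBody.BoseGas in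
/-- **The reward walk at a fixed potential, from the one-shell inequality.** For a repulsive finite-range `v`: IF there
are `η, K > 0`, `σ ∈ (0, 1]`, `ρ₀ > 0` such that for `0 < ρ < ρ₀`, eventually in `N`, every shell `(u, 4u]`, `4u ≤ σρa`,
whose upper half carries `(1−η)`-condensed near-minimisers of the rewarded functional obeys
`3R(2u) ≤ 2R(u) + R(4u) + KNu√(u/(ρa))`, THEN for every `τ > 0` there are `θ, ρ₀' > 0` with
`R(s) + (s/s₀)E₀ ≤ E₀ + (s/s₀)R(s₀) + sτN` for `0 < s ≤ s₀ = θρa`, `ρ < ρ₀'`, eventually in `N` (the body of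
`RewardChordBound` at `v`). Proof: `θ(η, K, τ, σ)` from `stub_secantWalk`; `ρ₀' := min ρ₀ ρ₃ ρ₄` with the PROVED rung
`rewardScaleChord_proof v hv (η/4) θ` and `PeriodicEnergyFinite_holds`; the walk instantiated at `Eᵢ = ⟨Ψ,HΨ⟩`,
`Dᵢ = N − n₀(Ψ) ≤ N`, `P = ((1−η)N ≤ n₀(Ψ))`. [folklore] -/
theorem rewardChordBound_at_of_shellModulus_at (v : ℝ → ENNReal)
    (hv : Literature.MathematicalPhysics.QuantumManyBody.BoseGas.IsRepulsiveFiniteRange v)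
    (hS : ∃ η K σ ρ₀ : ℝ, 0 < η ∧ 0 < K ∧ 0 < σ ∧ σ ≤ 1 ∧ 0 < ρ₀ ∧ ∀ ρ : ℝ, 0 < ρ → ρ < ρ₀ → ∀ᶠ N : ℕ in Filter.atTop,
        ∀ u : ℝ, 0 < u → 4 * u ≤ σ * ρ * (Literature.MathematicalPhysics.QuantumManyBody.BoseGas.scatteringLength v).toReal →
          (∀ w : ℝ, 2 * u < w → w ≤ 4 * u → ∃ δ : ENNReal, 0 < δ ∧
            ∀ Ψ : Literature.MathematicalPhysics.QuantumManyBody.BoseGas.PeriodicTrialState N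
              (Literature.MathematicalPhysics.QuantumManyBody.BoseGas.sideLength ρ N),
              Literature.MathematicalPhysics.QuantumManyBody.BoseGas.periodicEnergy v Ψ + ENNReal.ofReal w *
                  ((N : ENNReal) - Literature.MathematicalPhysics.QuantumManyBody.BoseGas.condensateOccupation N
                    (Literature.MathematicalPhysics.QuantumManyBody.BoseGas.sideLength ρ N) Ψ.ψ) ≤
                (⨅ Ψ' : Literature.MathematicalPhysics.QuantumManyBody.BoseGas.PeriodicTrialState N
                  (Literature.MathematicalPhysics.QuantumManyBody.BoseGas.sideLength ρ N),
                  (Literature.MathematicalPhysics.QuantumManyBody.BoseGas.periodicEnergy v Ψ' + ENNReal.ofReal w *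
                    ((N : ENNReal) - Literature.MathematicalPhysics.QuantumManyBody.BoseGas.condensateOccupation N
                      (Literature.MathematicalPhysics.QuantumManyBody.BoseGas.sideLength ρ N) Ψ'.ψ))) + δ →
              ENNReal.ofReal ((1 - η) * N) ≤
                Literature.MathematicalPhysics.QuantumManyBody.BoseGas.condensateOccupation N
                  (Literature.MathematicalPhysics.QuantumManyBody.BoseGas.sideLength ρ N) Ψ.ψ) →
          3 * (⨅ Ψ : Literature.MathematicalPhysics.QuantumManyBody.BoseGas.PeriodicTrialState N
              (Literature.MathematicalPhysics.QuantumManyBody.BoseGas.sideLength ρ N),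
              (Literature.MathematicalPhysics.QuantumManyBody.BoseGas.periodicEnergy v Ψ + ENNReal.ofReal (2 * u) *
                ((N : ENNReal) - Literature.MathematicalPhysics.QuantumManyBody.BoseGas.condensateOccupation N
                  (Literature.MathematicalPhysics.QuantumManyBody.BoseGas.sideLength ρ N) Ψ.ψ))) ≤
            2 * (⨅ Ψ : Literature.MathematicalPhysics.QuantumManyBody.BoseGas.PeriodicTrialState N
                (Literature.MathematicalPhysics.QuantumManyBody.BoseGas.sideLength ρ N),
                (Literature.MathematicalPhysics.QuantumManyBody.BoseGas.periodicEnergy v Ψ + ENNReal.ofReal u *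
                  ((N : ENNReal) - Literature.MathematicalPhysics.QuantumManyBody.BoseGas.condensateOccupation N
                    (Literature.MathematicalPhysics.QuantumManyBody.BoseGas.sideLength ρ N) Ψ.ψ))) +
              (⨅ Ψ : Literature.MathematicalPhysics.QuantumManyBody.BoseGas.PeriodicTrialState N
                (Literature.MathematicalPhysics.QuantumManyBody.BoseGas.sideLength ρ N),
                (Literature.MathematicalPhysics.QuantumManyBody.BoseGas.periodicEnergy v Ψ + ENNReal.ofReal (4 * u) *
                  ((N : ENNReal) - Literature.MathematicalPhysics.QuantumManyBody.BoseGas.condensateOccupation N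
                    (Literature.MathematicalPhysics.QuantumManyBody.BoseGas.sideLength ρ N) Ψ.ψ))) +
              ENNReal.ofReal (K * N * u * Real.sqrt (u / (ρ *
                (Literature.MathematicalPhysics.QuantumManyBody.BoseGas.scatteringLength v).toReal))))
    (τ : ℝ) (hτ : 0 < τ) :
    ∃ θ ρ₀ : ℝ, 0 < θ ∧ 0 < ρ₀ ∧ ∀ ρ : ℝ, 0 < ρ → ρ < ρ₀ → ∀ᶠ N : ℕ in Filter.atTop, ∀ s : ℝ, 0 < s → s ≤ θ * ρ * (Literature.MathematicalPhysics.QuantumManyBody.BoseGas.scatteringLength v).toReal → let L : ℝ := Literature.MathematicalPhysics.QuantumManyBody.BoseGas.sideLength ρ N; let s₀ : ℝ := θ * ρ * (Literature.MathematicalPhysics.QuantumManyBody.BoseGas.scatteringLength v).toReal; let R : ℝ → ENNReal := fun t => ⨅ Ψ : Literature.MathematicalPhysics.QuantumManyBody.BoseGas.PeriodicTrialState N L, (Literature.MathematicalPhysics.QuantumManyBody.BoseGas.periodicEnergy v Ψ + ENNReal.ofReal t * ((N : ENNReal) - Literature.MathematicalPhysics.QuantumManyBody.BoseGas.condensateOccupation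 N L Ψ.ψ)); R s + ENNReal.ofReal (s / s₀) * Literature.MathematicalPhysics.QuantumManyBody.BoseGas.periodicGroundStateEnergy v N L ≤ Literature.MathematicalPhysics.QuantumManyBody.BoseGas.periodicGroundStateEnergy v N L + ENNReal.ofReal (s / s₀) * R s₀ + ENNReal.ofReal (s * τ * N) := by
  obtain ⟨η, K, σ, ρ₁, hη, hK, hσ, hσ1, hρ₁, hSρ⟩ := hS
  obtain ⟨θ, hθ, _hθ4, hW⟩ := stub_secantWalk η K τ σ hη hK hτ hσ hσ1
  obtain ⟨ρ₃, hρ₃, hR1⟩ :=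
    Summit.AtomisticToContinuum.BoseEinsteinCondensation.Theorems.rewardScaleChord_proof v hv (η / 4) θ
      (by positivity) hθ
  obtain ⟨ρ₄, hρ₄, hFin⟩ :=
    Summit.AtomisticToContinuum.BoseEinsteinCondensation.Theses.BECRewardDescent.PeriodicEnergyFinite_holds v hv
  refine ⟨θ, min ρ₁ (min ρ₃ ρ₄), hθ, lt_min hρ₁ (lt_min hρ₃ hρ₄), fun ρ hρ hρlt => ?_⟩
  have h1 : ρ < ρ₁ := lt_of_lt_of_le hρlt (min_le_left _ _)
  have h3 : ρ < ρ₃ := lt_of_lt_of_le hρlt ((min_le_right _ _).trans (min_le_left _ _))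
  have h4 : ρ < ρ₄ := lt_of_lt_of_le hρlt ((min_le_right _ _).trans (min_le_right _ _))
  filter_upwards [hSρ ρ hρ h1, hR1 ρ hρ h3, hFin ρ hρ h4] with N hSN hRN hFN
  intro s hs hsle
  exact hW (PeriodicTrialState N (sideLength ρ N)) (fun Ψ => periodicEnergy v Ψ)
    (fun Ψ => (N : ℝ≥0∞) - condensateOccupation N (sideLength ρ N) Ψ.ψ)
    (fun Ψ => ENNReal.ofReal ((1 - η) * N) ≤ condensateOccupation N (sideLength ρ N) Ψ.ψ)
    (fun t => ⨅ Ψ : PeriodicTrialState N (sideLength ρ N), (periodicEnergy v Ψ +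
      ENNReal.ofReal t * ((N : ℝ≥0∞) - condensateOccupation N (sideLength ρ N) Ψ.ψ)))
    N ρ _ (fun _ => rfl) (fun _ => tsub_le_self) hFN
    (fun Ψ h =>
      Summit.AtomisticToContinuum.BoseEinsteinCondensation.Cruxes.RewardChordBound.Birth.ChordFromModulus.condensed_of_depletion_lt
        hη.le h)
    (fun hpos => hRN _ hpos le_rfl) (fun u hu h4u hcond => hSN u hu h4u hcond) s hs hsle

/-- **`RewardChordBound ⇐ ShellModulus`.** The route crux `RewardChordBound` (BY NAME) follows from the one-shell
three-energy inequality for every repulsive finite-range potential — verbatim the registered stub `stub_shellModulus`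
of the crux skeleton (line `dyadic-secant`): no Ky-Fan gap, no variance bound, no simplicity of rewarded ground states,
no differentiability of the reward curve is needed for the walk. [folklore] -/
theorem rewardChordBound_of_shellModulus
    (hShell :
    ∀ v : ℝ → ENNReal, Literature.MathematicalPhysics.QuantumManyBody.BoseGas.IsRepulsiveFiniteRange v →
      ∃ η K σ ρ₀ : ℝ, 0 < η ∧ 0 < K ∧ 0 < σ ∧ σ ≤ 1 ∧ 0 < ρ₀ ∧ ∀ ρ : ℝ, 0 < ρ → ρ < ρ₀ → ∀ᶠ N : ℕ in Filter.atTop,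
        ∀ u : ℝ, 0 < u → 4 * u ≤ σ * ρ * (Literature.MathematicalPhysics.QuantumManyBody.BoseGas.scatteringLength v).toReal →
          (∀ w : ℝ, 2 * u < w → w ≤ 4 * u → ∃ δ : ENNReal, 0 < δ ∧
            ∀ Ψ : Literature.MathematicalPhysics.QuantumManyBody.BoseGas.PeriodicTrialState N
              (Literature.MathematicalPhysics.QuantumManyBody.BoseGas.sideLength ρ N),
              Literature.MathematicalPhysics.QuantumManyBody.BoseGas.periodicEnergy v Ψ + ENNReal.ofReal w *
                  ((N : ENNReal) - Literature.MathematicalPhysics.QuantumManyBody.BoseGas.condensateOccupation N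
                    (Literature.MathematicalPhysics.QuantumManyBody.BoseGas.sideLength ρ N) Ψ.ψ) ≤
                (⨅ Ψ' : Literature.MathematicalPhysics.QuantumManyBody.BoseGas.PeriodicTrialState N
                  (Literature.MathematicalPhysics.QuantumManyBody.BoseGas.sideLength ρ N),
                  (Literature.MathematicalPhysics.QuantumManyBody.BoseGas.periodicEnergy v Ψ' + ENNReal.ofReal w *
                    ((N : ENNReal) - Literature.MathematicalPhysics.QuantumManyBody.BoseGas.condensateOccupation N
                      (Literature.MathematicalPhysics.QuantumManyBody.BoseGas.sideLength ρ N) Ψ'.ψ))) + δ →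
              ENNReal.ofReal ((1 - η) * N) ≤
                Literature.MathematicalPhysics.QuantumManyBody.BoseGas.condensateOccupation N
                  (Literature.MathematicalPhysics.QuantumManyBody.BoseGas.sideLength ρ N) Ψ.ψ) →
          3 * (⨅ Ψ : Literature.MathematicalPhysics.QuantumManyBody.BoseGas.PeriodicTrialState N
              (Literature.MathematicalPhysics.QuantumManyBody.BoseGas.sideLength ρ N),
              (Literature.MathematicalPhysics.QuantumManyBody.BoseGas.periodicEnergy v Ψ + ENNReal.ofReal (2 * u) *
                ((N : ENNReal) - Literature.MathematicalPhysics.QuantumManyBody.BoseGas.condensateOccupation N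
                  (Literature.MathematicalPhysics.QuantumManyBody.BoseGas.sideLength ρ N) Ψ.ψ))) ≤
            2 * (⨅ Ψ : Literature.MathematicalPhysics.QuantumManyBody.BoseGas.PeriodicTrialState N
                (Literature.MathematicalPhysics.QuantumManyBody.BoseGas.sideLength ρ N),
                (Literature.MathematicalPhysics.QuantumManyBody.BoseGas.periodicEnergy v Ψ + ENNReal.ofReal u *
                  ((N : ENNReal) - Literature.MathematicalPhysics.QuantumManyBody.BoseGas.condensateOccupation N
                    (Literature.MathematicalPhysics.QuantumManyBody.BoseGas.sideLength ρ N) Ψ.ψ))) +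
              (⨅ Ψ : Literature.MathematicalPhysics.QuantumManyBody.BoseGas.PeriodicTrialState N
                (Literature.MathematicalPhysics.QuantumManyBody.BoseGas.sideLength ρ N),
                (Literature.MathematicalPhysics.QuantumManyBody.BoseGas.periodicEnergy v Ψ + ENNReal.ofReal (4 * u) *
                  ((N : ENNReal) - Literature.MathematicalPhysics.QuantumManyBody.BoseGas.condensateOccupation N
                    (Literature.MathematicalPhysics.QuantumManyBody.BoseGas.sideLength ρ N) Ψ.ψ))) +
              ENNReal.ofReal (K * N * u * Real.sqrt (u / (ρ *
                (Literature.MathematicalPhysics.QuantumManyBody.BoseGas.scatteringLength v).toReal)))) :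
    Summit.AtomisticToContinuum.BoseEinsteinCondensation.Theses.BECRewardDescent.RewardChordBound :=
  fun v hv τ hτ => rewardChordBound_at_of_shellModulus_at v hv (hShell v hv) τ hτ

end Summit.AtomisticToContinuum.BoseEinsteinCondensation.Cruxes.RewardChordBound.DyadicSecant
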